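import Literature.AlgebraicGeometry.HodgeTheory.VeryGeneralHypersurfaceThreefoldSimpleH3
import Literature.AlgebraicGeometry.HodgeTheory.HypersurfaceHodgeFiltrationProofs
import HarnessLib

/-!
# The middle cohomology of a smooth hypersurface of degree `d ≥ m + 2` is not of Hodge level one (`h^{m,0} ≠ 0`); the very general hypersurface threefold has `H³` simple AND not of level one

Family `hodge`, layer `Literature/AlgebraicGeometry/HodgeTheory`. Consumer: cell `pub/hodge-nonav`,
chapter `ROUTE-P1V` row OD6 (cell Sketch `HodgeNonAV.P1V.hc22TimesCurve_of_H3_simple`), whose two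
hypotheses are `hsimple` — the named fact
`UniversalHypersurface.Mboro2017_veryGeneralHypersurfaceThreefold_H3_simple` of
`VeryGeneralHypersurfaceThreefoldSimpleH3` — and
`h30 : ∀ A, ¬ (⊤.map (A.pullback 3).hom ≤ ⨆_{p+q=3, p ≥ 1, q ≥ 1} A.hodgePQ 3 p q)` ("`H³` is not of
Hodge level one"). This file PROVES the second for every smooth hypersurface of degree `d ≥ m + 2`
in `ℙ^{m+1}_ℂ` (threefolds: `d ≥ 5`), with no new fact: the tree proves
`Voisin2003_hypersurface_hodgePQ_zero_ne_bot_holds` (`H^{0,m} ≠ 0` in every Hodge model of such a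
hypersurface: adjunction `ω_Y ≅ 𝒪_Y(d - m - 2)` realised by Griffiths' residue form, and
`∫ i^{m²} η ∧ η̄ > 0`; files `HypersurfaceGeometricGenusProofs`, `HypersurfaceHodgePQAssembly`,
`HypersurfaceHodgeFiltrationProofs`), and the Hodge pieces of a Hodge model form an internal direct
sum (structure field `HodgeModel.isInternal_hodgePQ`, Voisin I Thm. 6.18), so `H^{0,m}` is disjoint
from `⨆_{p,q ≥ 1} H^{p,q}` and cannot lie in it. The last theorem packages row OD6's two print
inputs along the residual set of the universal family of smooth hypersurfaces of degree `d ≥ 5` in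
`ℙ⁴`.

## References

* [VoisinHodgeI2002] C. Voisin, Hodge Theory and Complex Algebraic Geometry I (2002), §6.1.3
  Prop. 6.11, Thm. 6.18, §7.1.1.
* [VoisinHodgeII2003] C. Voisin, Hodge Theory and Complex Algebraic Geometry II (2003), §6.1.3
  Cor. 6.12, §6.3.1 Rem. 6.26.
* [Hartshorne1977] R. Hartshorne, Algebraic Geometry (1977), II Example 8.20.3 (`p_g ≥ 1` for
  `d ≥ n + 1`).
* [Mboro2017] R. Mboro, Remarks on approximate decompositions of the diagonal, Comm. Algebra 47
  (2019), §4 Lemma 4.3.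
-/

noncomputable section

open CategoryTheory AlgebraicGeometry
open _root_.Topology _root_.Filter
open Literature.AlgebraicTopology.SingularHomology

namespace Literature.AlgebraicGeometry.HodgeTheory

/-! ### Independence of the Hodge pieces of a Hodge model, and level `0` -/

namespace HodgeModel

variable {n k : ℕ} {Y : Motives.SchemeOver ℂ} (A : HodgeModel n Y)

/-- The Hodge pieces `A.hodgePQ k p q`, `(p, q) ∈ antidiagonal k`, of a Hodge model are independent
(transport of the structure field `isInternal_hodgePQ` along the de Rham comparison `Hᵏ_dR ≅ Hᵏ`).
Local copy of `HodgeModel.iSupIndep_hodgePQ`, which is declared in the barrier catalogue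
(`Barriers/HodgeConjecture/GeneralizedHodgeTrivialReasonsParity`), not imported here.
[cite: VoisinHodgeI2002, §6.1.3 Prop. 6.11 and Thm. 6.18] -/
private theorem iSupIndep_hodgePQ' (k : ℕ) :
    iSupIndep fun pq : ↥(Finset.HasAntidiagonal.antidiagonal k) ↦ A.hodgePQ k pq.1.1 pq.1.2 :=
  (iSupIndep_map_orderIso_iff (Submodule.orderIsoMapComap (A.deRham A.carrier k))).2
    (A.isInternal_hodgePQ k).submodule_iSupIndep

/-- **`H^{0,k} ≠ 0` forces Hodge level `0`:** if `A.hodgePQ k 0 k ≠ ⊥` then `Hᵏ(Y(ℂ); ℂ)` (read in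
the model `A` through the pull-back, an isomorphism) is NOT contained in the level-`≥ 1` part
`⨆_{p+q=k, p ≥ 1, q ≥ 1} H^{p,q}` — the consumer's spelling of "not of Hodge level one".
[cite: VoisinHodgeI2002, §6.1.3 Prop. 6.11 and §7.1.1] -/
theorem not_map_top_le_levelOne_of_hodgePQ_zero_ne_bot (hne : A.hodgePQ k 0 k ≠ ⊥) :
    ¬ (⊤ : Submodule ℂ (complexBetti Y k)).map (A.pullback k).hom ≤
      ⨆ (p : ℕ) (q : ℕ) (_ : p + q = k) (_ : 1 ≤ p) (_ : 1 ≤ q), A.hodgePQ k p q := by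
  intro hle
  apply hne
  -- the pull-back is onto, so the hypothesis says `⊤ ≤ ⨆_{p,q ≥ 1} H^{p,q}`
  have htop : (⊤ : Submodule ℂ (complexBetti Y k)).map (A.pullback k).hom = ⊤ := by
    rw [Submodule.map_top, LinearMap.range_eq_top]
    exact A.pullback_surjective k
  rw [htop, top_le_iff] at hle
  -- `(0, k)` is not an index with `p, q ≥ 1`: independence gives disjointness
  set t : ↥(Finset.HasAntidiagonal.antidiagonal k) → Submodule ℂ (singularCohomology ℂ ℂ A.carrier k) :=
    fun pq ↦ A.hodgePQ k pq.1.1 pq.1.2 with ht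
  let i₀ : ↥(Finset.HasAntidiagonal.antidiagonal k) :=
    ⟨(0, k), Finset.HasAntidiagonal.mem_antidiagonal.2 (zero_add k)⟩
  let S : Set ↥(Finset.HasAntidiagonal.antidiagonal k) := {pq | 1 ≤ pq.1.1 ∧ 1 ≤ pq.1.2}
  have hi₀ : i₀ ∉ S := fun h ↦ Nat.not_succ_le_zero 0 h.1
  have hdisj : Disjoint (t i₀) (⨆ i ∈ S, t i) := (A.iSupIndep_hodgePQ' k).disjoint_biSup hi₀
  have hS : (⨆ (p : ℕ) (q : ℕ) (_ : p + q = k) (_ : 1 ≤ p) (_ : 1 ≤ q), A.hodgePQ k p q) ≤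
      ⨆ i ∈ S, t i :=
    iSup_le fun p ↦ iSup_le fun q ↦ iSup_le fun hpq ↦ iSup_le fun hp ↦ iSup_le fun hq ↦
      le_biSup t (i := ⟨(p, q), Finset.HasAntidiagonal.mem_antidiagonal.2 hpq⟩) ⟨hp, hq⟩
  have hle' : t i₀ ≤ ⨆ i ∈ S, t i := le_top.trans (hle.symm.le.trans hS)
  exact hdisj.eq_bot_of_le hle'

end HodgeModel

section NotLevelOne

variable {m d : ℕ} {Y : Motives.SchemeOver ℂ}

/-- **Smooth hypersurfaces of degree `d ≥ m + 2` in `ℙ^{m+1}` have middle cohomology NOT of Hodge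
level one** (`H^{0,m} ≠ 0`, i.e. `p_g ≥ 1`: adjunction `ω_Y ≅ 𝒪_Y(d - m - 2)`), in the consumer's
spelling, for every Hodge model. A theorem: `Voisin2003_hypersurface_hodgePQ_zero_ne_bot_holds` +
`HodgeModel.not_map_top_le_levelOne_of_hodgePQ_zero_ne_bot`.
[cite: VoisinHodgeII2003, §6.1.3 Cor. 6.12 and Rem. 6.26] [cite: Hartshorne1977, II Example 8.20.3] -/
theorem IsSmoothHypersurface.not_map_top_le_levelOne (hm : 1 ≤ m) (hd : m + 2 ≤ d)
    (hY : Motives.IsSmoothHypersurface m d Y) (A : HodgeModel m Y) :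
    ¬ (⊤ : Submodule ℂ (complexBetti Y m)).map (A.pullback m).hom ≤
      ⨆ (p : ℕ) (q : ℕ) (_ : p + q = m) (_ : 1 ≤ p) (_ : 1 ≤ q), A.hodgePQ m p q :=
  A.not_map_top_le_levelOne_of_hodgePQ_zero_ne_bot
    (Voisin2003_hypersurface_hodgePQ_zero_ne_bot_holds m d hm hd Y hY A)

end NotLevelOne

namespace UniversalHypersurface

open Motives.UniversalHypersurface

section VeryGeneralThreefoldLevel

/-- **Every** fibre `Y_s` (`d ≥ 5`) of the universal family of smooth hypersurfaces of degree `d` in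
`ℙ⁴_ℂ` has `H³` not of Hodge level one — the hypothesis `h30` of the cell's
`hc22TimesCurve_of_H3_simple`, for all `s`, unconditionally. [cite: VoisinHodgeII2003, §6.1.3 Cor. 6.12 and Rem. 6.26]
[cite: Hartshorne1977, II Example 8.20.3] -/
theorem not_map_top_le_levelOne_fiberOver {d : ℕ} (hd : 5 ≤ d)
    (s : universalHypersurfaceBasePoints 3 d)
    (A : HodgeModel 3 (Motives.fiberOver (family ℂ 3 d) s)) :
    ¬ (⊤ : Submodule ℂ (complexBetti (Motives.fiberOver (family ℂ 3 d) s) 3)).map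
        (A.pullback 3).hom ≤
      ⨆ (p : ℕ) (q : ℕ) (_ : p + q = 3) (_ : 1 ≤ p) (_ : 1 ≤ q), A.hodgePQ 3 p q :=
  IsSmoothHypersurface.not_map_top_le_levelOne (by norm_num) (by omega)
    (isSmoothHypersurface_fiberOver 3 d (by norm_num) (by omega) s) A

/-- **Row OD6's two print inputs together, along the residual set** (`d ≥ 5`): for the very general
fibre `Y_s` of the universal family of smooth hypersurfaces of degree `d` in `ℙ⁴_ℂ`, `H³(Y_s, ℚ)` is a
simple rational Hodge structure (the named fact of `VeryGeneralHypersurfaceThreefoldSimpleH3`) AND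
not of Hodge level one (a theorem, for every fibre). [cite: Mboro2017, §4 Lemma 4.3 (arXiv p. 8)] [cite: VoisinHodgeII2003, §6.1.3 Cor. 6.12 and Rem. 6.26] -/
theorem Mboro2017_veryGeneralHypersurfaceThreefold_H3_simple.eventually_simple_and_not_levelOne
    (h : Mboro2017_veryGeneralHypersurfaceThreefold_H3_simple) {d : ℕ} (hd : 5 ≤ d) :
    ∀ᶠ s in residual (universalHypersurfaceBasePoints 3 d),
      IsSimpleRationalHodgeStructure 3 3 (Motives.fiberOver (family ℂ 3 d) s) ∧
        ∀ A : HodgeModel 3 (Motives.fiberOver (family ℂ 3 d) s),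
          ¬ (⊤ : Submodule ℂ (complexBetti (Motives.fiberOver (family ℂ 3 d) s) 3)).map
              (A.pullback 3).hom ≤
            ⨆ (p : ℕ) (q : ℕ) (_ : p + q = 3) (_ : 1 ≤ p) (_ : 1 ≤ q), A.hodgePQ 3 p q :=
  (h d (by omega)).mono fun s hs ↦ ⟨hs, fun A ↦ not_map_top_le_levelOne_fiberOver hd s A⟩

end VeryGeneralThreefoldLevel

end UniversalHypersurface

end Literature.AlgebraicGeometry.HodgeTheory

end
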